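/-
Copyright (c) 2026 the pub-hodgecm-mathlib formalisation cell (harness21).  Prover seat hodgecm-mathlib-K2E5-p17 (g3) (free E5 hand on the E3 road),
Track B «K2-LIT» ∕ h413 (`stmt-HodgeConjecture-24833`), line `K2_E3_EllipticInputs`, unit U12-d, §L road «U-iso-T», brick (G⁺-b) LINE SIDE, lemmas for (T1):
ball integrals of the unramified sign character `X(t) = (−1)^{v(t)}` on a non-archimedean local field.  2026-09-04.
-/
import Literature.NumberTheory.Automorphic.TateSelfDualHaar      -- ★ Tate: `fourierSB_indicator_vadd_primePowBall`, step decompositions; brings `LocalFieldHaarBalls`, `TateLocalZetaShells`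
import HarnessLib

/-!
# K2_E3 road (h413), §L — (G⁺-b) line side, LEMMAS: ball and shell integrals of the unramified sign character `X(t) = (−1)^{v(t)}`

Cell `pub/hodgecm-mathlib` (D-0151), Track B, seat K2E5-p17 (g3) ((G⁺-b) cut with K2E5-p10 (g4), §L lead K2E3-p12 (g4)).  `--supports stmt-HodgeConjecture-24833 --as helper`;
THEOREMS ONLY (no definition ∕ instance ∕ notation ∕ named fact ∕ `sorry`).  COUNT-NEUTRAL.

For a non-archimedean local field `F` (`q = #𝓀`, `𝔭^n = primePowBall F n`, additive Haar `μ`) and a WEIGHT `X : F → ℂ` with `X = (−1)^j` on the shell `𝔭^j ∖ 𝔭^{j+1}` and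
`X 0 = 0` — the unramified quadratic character `η_{E∕F}` extended by zero, kept abstract so that no character API enters — we compute, WITHOUT infinite shell sums:
* §1 `setIntegral_shell_sign` (`∫_{shell n} X = (−1)^n μ(shell n)`), `integral_indicator_comp_uniformizer_sign` (`t ↦ ϖt` flips the sign and shifts balls), and
  **`setIntegral_primePowBall_sign`**: `∫_{𝔭^n} X dμ = (−1)^n · (1 − q⁻¹)∕(1 + q⁻¹) · μ(𝔭^n)` (from `𝔭^n = shell n ⊔ 𝔭^{n+1}` and the self-similarity `∫_{𝔭^{n+1}} X = −q⁻¹ ∫_{𝔭^n} X`).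
These feed the line inversion (T1) «`∫ X·Ĝ = γ₀·(Z₀(G) + c₀·G(0))`» of `K2E3LocalFieldQuadraticCharLineInversion` (next file).
[Tate1950, §2.2, §2.5] [BushnellHenniart2006, §23.5] [Weil1974BNT, Ch. VII §2].
HONEST LABEL: HC_CM is proved only modulo the 7 printed citations (2 remaining named inputs: hLiu418 = stmt-HodgeConjecture-24832, h413 = stmt-HodgeConjecture-24833)
until rung 0 closes; count-neutral.
-/

set_option autoImplicit false
set_option linter.dupNamespace false   -- `Summit.HodgeConjecture.HodgeConjecture.…` (D-0017 nested layout; lakefile exemption for Summits)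

noncomputable section

open MeasureTheory Measure Filter Topology Set
open scoped NNReal ENNReal Pointwise
open Literature.NumberTheory.Automorphic Literature.NumberTheory.Automorphic.LocalFieldHaar
open Literature.NumberTheory.GaloisRepresentations Literature.NumberTheory.GaloisRepresentations.IsNonarchimedeanLocalField

namespace Summit.HodgeConjecture.HodgeConjecture.Cruxes.H413.K2E3LocalFieldSignCharLineLemmas

variable {F : Type*} [Field F] [ValuativeRel F] [TopologicalSpace F] [IsNonarchimedeanLocalField F] [MeasurableSpace F] [BorelSpace F]
  (μ : Measure F) [μ.IsAddHaarMeasure]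
  {X : F → ℂ} (hXm : Measurable X) (hXb : ∀ x, ‖X x‖ ≤ 1)
  (hX : ∀ (j : ℤ) (x : F), x ∈ primePowBall F j \ primePowBall F (j + 1) → X x = (-1) ^ j) (hX0 : X 0 = 0)
  {ϖ : F} (hϖ : normAbs F ϖ = (residueFieldCard F : ℝ≥0)⁻¹)

/-! ## §1  Shell and ball integrals of the sign weight -/

omit [Field F] [ValuativeRel F] [TopologicalSpace F] [IsNonarchimedeanLocalField F] [BorelSpace F] [μ.IsAddHaarMeasure] in
include hXm hXb in
/-- `X` is integrable on every set of finite measure. [folklore] -/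
theorem integrableOn_sign {s : Set F} (hs : μ s < ⊤) : IntegrableOn X s μ :=
  Measure.integrableOn_of_bounded (M := 1) hs.ne hXm.aestronglyMeasurable (Filter.Eventually.of_forall hXb)

omit [μ.IsAddHaarMeasure] in
include hX in
/-- `∫_{shell n} X = (−1)^n · μ(shell n)`. [cite: Tate1950, §2.5] -/
theorem setIntegral_shell_sign (n : ℤ) :
    ∫ t in primePowBall F n \ primePowBall F (n + 1), X t ∂μ = (-1) ^ n * (μ.real (primePowBall F n \ primePowBall F (n + 1)) : ℂ) := by
  rw [setIntegral_congr_fun (measurableSet_shell n) (fun t ht => hX n t ht), setIntegral_const, Complex.real_smul, mul_comm]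

omit [MeasurableSpace F] [BorelSpace F] in
include hX hX0 hϖ in
/-- `X(ϖ t) = −X(t)`. [folklore] -/
theorem sign_uniformizer_mul (t : F) : X (ϖ * t) = - X t := by
  by_cases ht : t = 0
  · rw [ht, mul_zero, hX0, neg_zero]
  · -- `t` lies in a unique shell `j`, and `ϖ t` in the shell `j + 1`
    obtain ⟨j, hj⟩ : ∃ j : ℤ, t ∈ primePowBall F j \ primePowBall F (j + 1) := by
      obtain ⟨j, hj⟩ := exists_normAbs_eq_inv_zpow (F := F) ht
      exact ⟨j, (mem_shell_iff).2 hj⟩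
    have hq0 : ((residueFieldCard F : ℝ≥0))⁻¹ ≠ 0 := inv_ne_zero (Nat.cast_ne_zero.2 (residueFieldCard_ne_zero F))
    have hϖt : ϖ * t ∈ primePowBall F (j + 1) \ primePowBall F (j + 1 + 1) := by
      rw [mem_shell_iff] at hj ⊢
      rw [map_mul, hϖ, hj, zpow_add_one₀ hq0, mul_comm]
    rw [hX _ _ hϖt, hX _ _ hj, zpow_add₀ (by norm_num : (-1 : ℂ) ≠ 0), zpow_one, mul_neg_one]

include hϖ in
omit [MeasurableSpace F] [BorelSpace F] in
/-- `ϖ t ∈ 𝔭^{n+1} ↔ t ∈ 𝔭^n`. [folklore] -/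
theorem uniformizer_mul_mem_iff (n : ℤ) (t : F) : ϖ * t ∈ primePowBall F (n + 1) ↔ t ∈ primePowBall F n := by
  have h := smul_primePowBall (F := F) (a := ϖ) (k := 1) (by rw [hϖ, zpow_one]) n
  have hϖ0 : ϖ ≠ 0 := by
    rintro rfl
    rw [map_zero] at hϖ
    exact (inv_ne_zero (Nat.cast_ne_zero.2 (residueFieldCard_ne_zero F))) hϖ.symm
  rw [← h, ← smul_eq_mul, Set.smul_mem_smul_set_iff₀ hϖ0]

include hX hX0 hϖ in
/-- **Self-similarity**: `∫_{𝔭^{n+1}} X = −q⁻¹ · ∫_{𝔭^n} X` (substitute `t = ϖ t′`: the ball shrinks by one step, the sign flips, `dμ(ϖt′) = q⁻¹ dμ(t′)`).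
[cite: Tate1950, §2.2 Lemma 2.2.5] -/
theorem setIntegral_primePowBall_succ_sign (n : ℤ) :
    ∫ t in primePowBall F (n + 1), X t ∂μ = -((residueFieldCard F : ℂ)⁻¹) * ∫ t in primePowBall F n, X t ∂μ := by
  have hϖ0 : ϖ ≠ 0 := by
    rintro rfl
    rw [map_zero] at hϖ
    exact (inv_ne_zero (Nat.cast_ne_zero.2 (residueFieldCard_ne_zero F))) hϖ.symm
  have key := integral_comp_mul_left μ hϖ0 (fun t => (primePowBall F (n + 1)).indicator X t)
  have hfun : (fun t => (primePowBall F (n + 1)).indicator X (ϖ * t)) = fun t => -((primePowBall F n).indicator X t) := by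
    funext t
    by_cases ht : t ∈ primePowBall F n
    · rw [Set.indicator_of_mem ((uniformizer_mul_mem_iff hϖ n t).2 ht), Set.indicator_of_mem ht, sign_uniformizer_mul hX hX0 hϖ]
    · rw [Set.indicator_of_notMem (fun h => ht ((uniformizer_mul_mem_iff hϖ n t).1 h)), Set.indicator_of_notMem ht, neg_zero]
  rw [hfun, integral_neg, integral_indicator (measurableSet_primePowBall _), integral_indicator (measurableSet_primePowBall _),
    map_inv₀, hϖ, inv_inv] at key
  -- `key : -∫_{𝔭^n} X = (q : ℝ) • ∫_{𝔭^{n+1}} X`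
  have hq : (residueFieldCard F : ℂ) ≠ 0 := Nat.cast_ne_zero.2 (residueFieldCard_ne_zero F)
  rw [Complex.real_smul] at key
  have : ((((residueFieldCard F : ℝ≥0)) : ℝ) : ℂ) = (residueFieldCard F : ℂ) := by norm_cast
  rw [this] at key
  have h3 : (∫ t in primePowBall F (n + 1), X t ∂μ) =
      (residueFieldCard F : ℂ)⁻¹ * ((residueFieldCard F : ℂ) * ∫ t in primePowBall F (n + 1), X t ∂μ) := by
    rw [← mul_assoc, inv_mul_cancel₀ hq, one_mul]
  rw [h3, ← key]
  ring

include hXm hXb hX hX0 hϖ in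
/-- **`∫_{𝔭^n} X dμ = (−1)^n · (1 − q⁻¹)∕(1 + q⁻¹) · μ(𝔭^n)`** — the regularised «value at `0`» of the unramified quadratic character on a ball, with no infinite shell sum:
`𝔭^n = shell ⊔ 𝔭^{n+1}`, `∫_{shell n} X = (−1)^n μ(shell n)`, `∫_{𝔭^{n+1}} X = −q⁻¹∫_{𝔭^n} X`. [cite: Tate1950, §2.5] [cite: BushnellHenniart2006, §23.5] -/
theorem setIntegral_primePowBall_sign (n : ℤ) :
    ∫ t in primePowBall F n, X t ∂μ =
      (-1) ^ n * ((1 - (residueFieldCard F : ℂ)⁻¹) / (1 + (residueFieldCard F : ℂ)⁻¹)) * (μ.real (primePowBall F n) : ℂ) := by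
  haveI : T2Space F := (isLocalField F).toT2Space
  haveI : LocallyCompactSpace F := (isLocalField F).toLocallyCompactSpace
  have hsub : primePowBall F (n + 1) ⊆ primePowBall F n := primePowBall_antitone (by omega)
  have hfin : μ (primePowBall F n) < ⊤ := (isCompact_primePowBall n).measure_lt_top
  have hsplit := setIntegral_sdiff (measurableSet_primePowBall (n + 1)) (integrableOn_sign μ hXm hXb hfin) hsub
  rw [setIntegral_shell_sign μ hX n] at hsplit
  have hsucc := setIntegral_primePowBall_succ_sign μ hX hX0 hϖ n
  have hshell : (μ.real (primePowBall F n \ primePowBall F (n + 1)) : ℂ) = (1 - (residueFieldCard F : ℂ)⁻¹) * (μ.real (primePowBall F n) : ℂ) := by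
    rw [measureReal_shell μ n, measureReal_primePowBall μ n]
    push_cast
    ring
  have hq : (residueFieldCard F : ℂ) ≠ 0 := Nat.cast_ne_zero.2 (residueFieldCard_ne_zero F)
  have hq1 : (1 + (residueFieldCard F : ℂ)⁻¹) ≠ 0 := by
    have h : ((1 + (residueFieldCard F : ℝ)⁻¹ : ℝ) : ℂ) ≠ 0 := Complex.ofReal_ne_zero.2 (by positivity)
    simpa using h
  rw [hshell, hsucc] at hsplit
  have h4 : (∫ t in primePowBall F n, X t ∂μ) * (1 + (residueFieldCard F : ℂ)⁻¹) =
      (-1) ^ n * ((1 - (residueFieldCard F : ℂ)⁻¹) * (μ.real (primePowBall F n) : ℂ)) := by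
    linear_combination (-1 : ℂ) * hsplit
  have h5 : (∫ t in primePowBall F n, X t ∂μ) =
      (∫ t in primePowBall F n, X t ∂μ) * (1 + (residueFieldCard F : ℂ)⁻¹) / (1 + (residueFieldCard F : ℂ)⁻¹) := by
    rw [mul_div_cancel_right₀ _ hq1]
  rw [h5, h4]
  ring

/-! ## §2  The `ψ(a·)`-twisted shell and ball integrals -/

section Twisted
variable (ψ : AddChar F Circle) (hψc : Continuous ψ) {m : ℤ} (hm : ψ.HasConductorExp m)

omit [μ.IsAddHaarMeasure] in
include hXm hXb hψc in
/-- `t ↦ X(t)·ψ(a t)` is integrable on every set of finite measure. [folklore] -/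
theorem integrableOn_sign_mul_addChar (a : F) {s : Set F} (hs : μ s < ⊤) :
    IntegrableOn (fun t => X t * ((ψ (a * t) : Circle) : ℂ)) s μ := by
  refine Measure.integrableOn_of_bounded (M := 1) hs.ne
    (hXm.mul (continuous_subtype_val.comp (hψc.comp (continuous_const.mul continuous_id))).measurable).aestronglyMeasurable
    (Filter.Eventually.of_forall fun t => ?_)
  rw [norm_mul, Circle.norm_coe, mul_one]
  exact hXb t

omit [μ.IsAddHaarMeasure] in
include hψc in
/-- `t ↦ ψ(a t)` is integrable on every set of finite measure. [folklore] -/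
theorem integrableOn_addChar_mul (a : F) {s : Set F} (hs : μ s < ⊤) :
    IntegrableOn (fun t => ((ψ (a * t) : Circle) : ℂ)) s μ := by
  refine Measure.integrableOn_of_bounded (M := 1) hs.ne
    (continuous_subtype_val.comp (hψc.comp (continuous_const.mul continuous_id))).measurable.aestronglyMeasurable
    (Filter.Eventually.of_forall fun t => ?_)
  rw [Circle.norm_coe]

open scoped Classical in
include hm in
/-- `∫_{𝔭^j} ψ(a t) dt = [a ∈ 𝔭^{m−j}] · μ(𝔭^j)` (★ `setIntegral_primePowBall_addChar_mul`, arguments commuted). [cite: Tate1950, §2.5] -/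
theorem setIntegral_primePowBall_addChar_mul_left (j : ℤ) (a : F) :
    ∫ t in primePowBall F j, ((ψ (a * t) : Circle) : ℂ) ∂μ = if a ∈ primePowBall F (m - j) then (μ.real (primePowBall F j) : ℂ) else 0 := by
  simp_rw [mul_comm a]
  exact setIntegral_primePowBall_addChar_mul μ hm j a

open scoped Classical in
include hX hψc hm in
/-- **Twisted shell integral**: `∫_{shell j} X(t) ψ(a t) dt = (−1)^j · ([a ∈ 𝔭^{m−j}] μ(𝔭^j) − [a ∈ 𝔭^{m−j−1}] μ(𝔭^{j+1}))`. [cite: Tate1950, §2.5] -/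
theorem setIntegral_shell_sign_mul_addChar (j : ℤ) (a : F) :
    ∫ t in primePowBall F j \ primePowBall F (j + 1), X t * ((ψ (a * t) : Circle) : ℂ) ∂μ =
      (-1) ^ j * ((if a ∈ primePowBall F (m - j) then (μ.real (primePowBall F j) : ℂ) else 0) -
        (if a ∈ primePowBall F (m - (j + 1)) then (μ.real (primePowBall F (j + 1)) : ℂ) else 0)) := by
  haveI : T2Space F := (isLocalField F).toT2Space
  haveI : LocallyCompactSpace F := (isLocalField F).toLocallyCompactSpace
  have h1 : ∫ t in primePowBall F j \ primePowBall F (j + 1), X t * ((ψ (a * t) : Circle) : ℂ) ∂μ =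
      ∫ t in primePowBall F j \ primePowBall F (j + 1), (-1) ^ j * ((ψ (a * t) : Circle) : ℂ) ∂μ :=
    setIntegral_congr_fun (measurableSet_shell j) (fun t ht => by rw [hX j t ht])
  rw [h1, integral_const_mul, setIntegral_sdiff (measurableSet_primePowBall (j + 1))
    (integrableOn_addChar_mul μ ψ hψc a (isCompact_primePowBall j).measure_lt_top) (primePowBall_antitone (by omega)),
    setIntegral_primePowBall_addChar_mul_left μ ψ hm, setIntegral_primePowBall_addChar_mul_left μ ψ hm]

omit [MeasurableSpace F] [BorelSpace F] in
/-- `a ∈ 𝔭^k ↔ k ≤ v` for `‖a‖ = (q⁻¹)^v`. [folklore] -/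
theorem mem_primePowBall_iff_le {a : F} {v : ℤ} (ha : normAbs F a = ((residueFieldCard F : ℝ≥0)⁻¹) ^ v) (k : ℤ) :
    a ∈ primePowBall F k ↔ k ≤ v := by
  show normAbs F a ≤ ((residueFieldCard F : ℝ≥0)⁻¹) ^ k ↔ k ≤ v
  rw [ha]
  exact zpow_le_zpow_iff_right_of_lt_one₀ inv_residueFieldCard_pos inv_residueFieldCard_lt_one

include hXm hXb hX hψc hm in
/-- The twisted shells strictly between `𝔭^n` and `𝔭^{m−v−1}` contribute nothing: `∫_{𝔭^n ∖ 𝔭^{n+i}} X(t) ψ(a t) dt = 0` whenever `n + i ≤ m − v − 1`, `‖a‖ = (q⁻¹)^v`.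
[cite: Tate1950, §2.5] -/
theorem setIntegral_sdiff_sign_mul_addChar_eq_zero {a : F} {v : ℤ} (ha : normAbs F a = ((residueFieldCard F : ℝ≥0)⁻¹) ^ v) (n : ℤ) :
    ∀ i : ℕ, n + i ≤ m - v - 1 → ∫ t in primePowBall F n \ primePowBall F (n + i), X t * ((ψ (a * t) : Circle) : ℂ) ∂μ = 0 := by
  haveI : T2Space F := (isLocalField F).toT2Space
  haveI : LocallyCompactSpace F := (isLocalField F).toLocallyCompactSpace
  intro i
  induction i with
  | zero => intro _; simp
  | succ i ih =>
    intro hi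
    have hset : primePowBall F n \ primePowBall F (n + (i + 1 : ℕ)) =
        (primePowBall F n \ primePowBall F (n + i)) ∪ (primePowBall F (n + i) \ primePowBall F (n + i + 1)) := by
      ext t
      simp only [Set.mem_sdiff, Set.mem_union, Nat.cast_add, Nat.cast_one, ← add_assoc]
      constructor
      · rintro ⟨h1, h2⟩
        by_cases h3 : t ∈ primePowBall F (n + i)
        · exact Or.inr ⟨h3, h2⟩
        · exact Or.inl ⟨h1, h3⟩
      · rintro (⟨h1, h2⟩ | ⟨h1, h2⟩)
        · exact ⟨h1, fun h => h2 (primePowBall_antitone (by omega) h)⟩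
        · exact ⟨primePowBall_antitone (by omega) h1, h2⟩
    have hdisj : Disjoint (primePowBall F n \ primePowBall F (n + i)) (primePowBall F (n + i) \ primePowBall F (n + i + 1)) :=
      Set.disjoint_left.2 fun t ht ht' => ht.2 ht'.1
    rw [hset, setIntegral_union hdisj (measurableSet_shell _)
      ((integrableOn_sign_mul_addChar μ hXm hXb ψ hψc a (isCompact_primePowBall n).measure_lt_top).mono_set Set.sdiff_subset)
      ((integrableOn_sign_mul_addChar μ hXm hXb ψ hψc a (isCompact_primePowBall (n + i)).measure_lt_top).mono_set Set.sdiff_subset),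
      ih (by push_cast at hi; omega), setIntegral_shell_sign_mul_addChar μ hX ψ hψc hm, zero_add]
    have h1 : a ∉ primePowBall F (m - (n + i)) := fun h => by
      have := (mem_primePowBall_iff_le ha _).1 h; push_cast at hi; omega
    have h2 : a ∉ primePowBall F (m - (n + i + 1)) := fun h => by
      have := (mem_primePowBall_iff_le ha _).1 h; push_cast at hi; omega
    rw [if_neg h1, if_neg h2, sub_zero, mul_zero]

end Twisted

section TwistedBall
variable (ψ : AddChar F Circle) (hψc : Continuous ψ) {m : ℤ} (hm : ψ.HasConductorExp m)

omit [MeasurableSpace F] [BorelSpace F] in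
/-- `a t ∈ 𝔭^m` for `‖a‖ = (q⁻¹)^v` and `t ∈ 𝔭^{m−v}`. [folklore] -/
theorem mul_mem_primePowBall_of_mem {a : F} {v : ℤ} (ha : normAbs F a = ((residueFieldCard F : ℝ≥0)⁻¹) ^ v) {t : F}
    (ht : t ∈ primePowBall F (m - v)) : a * t ∈ primePowBall F m := by
  show normAbs F (a * t) ≤ ((residueFieldCard F : ℝ≥0)⁻¹) ^ m
  have ht' : normAbs F t ≤ ((residueFieldCard F : ℝ≥0)⁻¹) ^ (m - v) := ht
  rw [map_mul, ha]
  calc ((residueFieldCard F : ℝ≥0)⁻¹) ^ v * normAbs F t ≤ ((residueFieldCard F : ℝ≥0)⁻¹) ^ v * ((residueFieldCard F : ℝ≥0)⁻¹) ^ (m - v) :=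
        mul_le_mul_of_nonneg_left ht' (by positivity)
    _ = ((residueFieldCard F : ℝ≥0)⁻¹) ^ m := by
        rw [← zpow_add₀ (inv_ne_zero (Nat.cast_ne_zero.2 (residueFieldCard_ne_zero F)))]; congr 1; ring

open scoped Classical in
include hXm hXb hX hX0 hϖ hψc hm in
/-- **Twisted ball integral**: for `‖a‖ = (q⁻¹)^v` and `n ≤ m − v − 1`, `∫_{𝔭^n} X(t) ψ(a t) dt = (−1)^{m−v} · 2∕(1 + q⁻¹) · μ(𝔭^{m−v})` — only the shell `m − v − 1`
(where `∫_{𝔭^{m−v−1}} ψ(a·) = 0`, `∫_{𝔭^{m−v}} ψ(a·) = μ(𝔭^{m−v})`) and the ball `𝔭^{m−v}` (where `ψ(a·) ≡ 1`) contribute. [cite: Tate1950, §2.5] [cite: BushnellHenniart2006, §23.5] -/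
theorem setIntegral_primePowBall_sign_mul_addChar {a : F} {v : ℤ} (ha : normAbs F a = ((residueFieldCard F : ℝ≥0)⁻¹) ^ v) {n : ℤ}
    (hn : n ≤ m - v - 1) :
    ∫ t in primePowBall F n, X t * ((ψ (a * t) : Circle) : ℂ) ∂μ =
      (-1) ^ (m - v) * (2 / (1 + (residueFieldCard F : ℂ)⁻¹)) * (μ.real (primePowBall F (m - v)) : ℂ) := by
  haveI : T2Space F := (isLocalField F).toT2Space
  haveI : LocallyCompactSpace F := (isLocalField F).toLocallyCompactSpace
  have hint : ∀ k : ℤ, IntegrableOn (fun t => X t * ((ψ (a * t) : Circle) : ℂ)) (primePowBall F k) μ := fun k =>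
    integrableOn_sign_mul_addChar μ hXm hXb ψ hψc a (isCompact_primePowBall k).measure_lt_top
  -- (1) the shells between `𝔭^n` and `𝔭^{m−v−1}` contribute nothing
  have hi : n + ((m - v - 1 - n).toNat : ℕ) = m - v - 1 := by
    rw [Int.toNat_of_nonneg (by omega)]; ring
  have h0 := setIntegral_sdiff_sign_mul_addChar_eq_zero μ hXm hXb hX ψ hψc hm ha n (m - v - 1 - n).toNat hi.le
  rw [hi] at h0
  have h1 := setIntegral_sdiff (measurableSet_primePowBall (m - v - 1)) (hint n) (primePowBall_antitone hn)
  rw [h0] at h1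
  -- so `∫_{𝔭^n} = ∫_{𝔭^{m−v−1}}`
  have h2 : ∫ t in primePowBall F n, X t * ((ψ (a * t) : Circle) : ℂ) ∂μ = ∫ t in primePowBall F (m - v - 1), X t * ((ψ (a * t) : Circle) : ℂ) ∂μ := by
    linear_combination -h1
  -- (2) split off the shell `m − v − 1`
  have h3 := setIntegral_sdiff (measurableSet_primePowBall (m - v - 1 + 1)) (hint (m - v - 1)) (primePowBall_antitone (by omega))
  rw [setIntegral_shell_sign_mul_addChar μ hX ψ hψc hm (m - v - 1) a] at h3
  have hv1 : a ∉ primePowBall F (m - (m - v - 1)) := fun h => by have := (mem_primePowBall_iff_le ha _).1 h; omega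
  have hv2 : a ∈ primePowBall F (m - (m - v - 1 + 1)) := (mem_primePowBall_iff_le ha _).2 (by omega)
  rw [if_neg hv1, if_pos hv2] at h3
  -- (3) on `𝔭^{m−v}` the phase is `1`
  have h4 : ∫ t in primePowBall F (m - v - 1 + 1), X t * ((ψ (a * t) : Circle) : ℂ) ∂μ =
      (-1) ^ (m - v) * ((1 - (residueFieldCard F : ℂ)⁻¹) / (1 + (residueFieldCard F : ℂ)⁻¹)) * (μ.real (primePowBall F (m - v)) : ℂ) := by
    rw [show m - v - 1 + 1 = m - v by ring, ← setIntegral_primePowBall_sign μ hXm hXb hX hX0 hϖ (m - v)]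
    refine setIntegral_congr_fun (measurableSet_primePowBall _) fun t ht => ?_
    rw [hm.1 _ (mul_mem_primePowBall_of_mem ha ht), Circle.coe_one, mul_one]
  have hq1 : (1 + (residueFieldCard F : ℂ)⁻¹) ≠ 0 := by
    have h : ((1 + (residueFieldCard F : ℝ)⁻¹ : ℝ) : ℂ) ≠ 0 := Complex.ofReal_ne_zero.2 (by positivity)
    simpa using h
  have hpow : ((-1 : ℂ)) ^ (m - v - 1) = -(-1) ^ (m - v) := by
    rw [zpow_sub_one₀ (by norm_num : (-1 : ℂ) ≠ 0)]; ring
  rw [h2]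
  rw [show m - v - 1 + 1 = m - v by ring] at h3 h4
  rw [h4, hpow] at h3
  have key : (1 - (residueFieldCard F : ℂ)⁻¹) / (1 + (residueFieldCard F : ℂ)⁻¹) + 1 = 2 / (1 + (residueFieldCard F : ℂ)⁻¹) := by
    rw [div_add' _ _ _ hq1]; congr 1; ring
  linear_combination (-1 : ℂ) * h3 + (-1) ^ (m - v) * (μ.real (primePowBall F (m - v)) : ℂ) * key

end TwistedBall

/-! ## §3  The regularised ball values: `∫_{shell j} X ‖·‖⁻¹ = (−1)^j (1 − q⁻¹) μ(𝒪)` and the alternating sums over `𝒪 ∖ 𝔭^k`, `𝔭^{−k} ∖ 𝒪` -/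

section NormInv

omit [MeasurableSpace F] [BorelSpace F] in
/-- On the shell `j`, `‖s‖⁻¹ = q^j` (as a complex number). [folklore] -/
theorem normInv_eq_of_mem_shell {j : ℤ} {s : F} (hs : s ∈ primePowBall F j \ primePowBall F (j + 1)) :
    ((((normAbs F s)⁻¹ : ℝ≥0) : ℝ) : ℂ) = (residueFieldCard F : ℂ) ^ j := by
  rw [(mem_shell_iff).1 hs, inv_zpow', zpow_neg, inv_inv]
  push_cast
  rfl

include hX in
/-- **`∫_{shell j} X(s) ‖s‖⁻¹ ds = (−1)^j · (1 − q⁻¹) · μ(𝒪)`** — the same for every shell. [cite: Tate1950, §2.5] -/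
theorem setIntegral_shell_sign_mul_normInv (j : ℤ) :
    ∫ s in primePowBall F j \ primePowBall F (j + 1), X s * ((((normAbs F s)⁻¹ : ℝ≥0) : ℝ) : ℂ) ∂μ =
      (-1) ^ j * (1 - (residueFieldCard F : ℂ)⁻¹) * (μ.real (primePowBall F 0) : ℂ) := by
  have h1 : ∫ s in primePowBall F j \ primePowBall F (j + 1), X s * ((((normAbs F s)⁻¹ : ℝ≥0) : ℝ) : ℂ) ∂μ =
      ∫ s in primePowBall F j \ primePowBall F (j + 1), ((-1 : ℂ) ^ j * (residueFieldCard F : ℂ) ^ j) ∂μ :=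
    setIntegral_congr_fun (measurableSet_shell j) (fun s hs => by rw [hX j s hs, normInv_eq_of_mem_shell hs])
  rw [h1, setIntegral_const, Complex.real_smul, measureReal_shell μ j]
  have hq : (residueFieldCard F : ℂ) ≠ 0 := Nat.cast_ne_zero.2 (residueFieldCard_ne_zero F)
  push_cast
  have hz : (residueFieldCard F : ℂ)⁻¹ ^ j * (residueFieldCard F : ℂ) ^ j = 1 := by
    rw [inv_zpow, inv_mul_cancel₀ (zpow_ne_zero j hq)]
  linear_combination ((-1 : ℂ) ^ j * (1 - (residueFieldCard F : ℂ)⁻¹) * (μ.real (primePowBall F 0) : ℂ)) * hz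

end NormInv

end Summit.HodgeConjecture.HodgeConjecture.Cruxes.H413.K2E3LocalFieldSignCharLineLemmas

end
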